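import Mathlib
import Literature.Probability.LatticeModels.HighDimPointwiseTriviality
import Literature.Probability.LatticeModels.CriticalTwoPointLower
import Summits.CriticalPhenomena.Ising3DConformalLimit.Theorems.GaussianScaleMixtureCriticalTwoPointGSMJsCesaroIdentity

/-!
# Crux `CriticalTwoPointGSM`, line `Sketch` (canonical-lift spine): the diagonal Cesàro identity

Route `GaussianScaleMixture` of `Ising3DConformalLimit`, crux `CriticalTwoPointGSM`
(stmt-CriticalPhenomena-8365), line `Sketch`, canonical-lift spine (seat c1), stub
`diag_cesaroIdentity` — a nine-direction DIVIDEND of the spine: the DIAGONAL Cesàro/DFT identity.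

Write `G = criticalTwoPoint 3` for the critical two-point function `⟨σ₀ σ_x⟩⁺_{β_c}` of the
nearest-neighbour Ising model on `ℤ³`, `u = e₀ - e₁ = Pi.single 0 1 - Pi.single 1 1` for the
normal step of the swap-mirror plane `{x₀ = x₁}`, `ι w = (w₀, w₀, w₁) = w 0 • (e₀ + e₁) + w 1 • e₂`
for the plane point of `w ∈ ℤ²`, and `Gd n w = G(ι w + n • u)` (`n ∈ ℤ`) for the DIAGONAL
two-point data (the two-point function at the site `(w₀ + n, w₀ - n, w₁)`).

The diagonal joint spectral measure is built from finite-`N` approximants indexed by the `(2N)²`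
discrete momenta `k_j = πj/N`, `j ∈ (-N, N]²`, of the plane. This file is the finite-sum
bookkeeping of that construction: GIVEN the character orthogonality on `(ℤ/2Nℤ)²`
(`∑_{j ∈ (-N,N]²} cos(k_j·u) = (2N)²·[2N ∣ u]`, the statement of the sibling stub `js_trigSum`,
taken here as the hypothesis `htrig`), for `N ≥ 1`, `n ∈ ℤ` and `z ∈ ℤ²` with `|zᵢ| < N`,

`∑_j cos(k_j·z) ∑_{x,y ∈ [0,N)²} (cos(k_j·x) cos(k_j·y) + sin(k_j·x) sin(k_j·y)) Gd n (x - y)`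
`= (2N)² · #{(x,y) ∈ [0,N)² × [0,N)² : x - y = z} · Gd n z`.

Proof: the abstract identity `CriticalTwoPointGSMJs.DiagCesaroIdentity.main` holds for EVERY even
weight `F : ℤ² → ℝ` (`F(-w) = F w`) in place of `Gd n` — `cos a cos b + sin a sin b = cos(a - b)`
and the phase is linear, so the inner summand is `cos(k_j·(x-y)) F(x-y)`; swap the sums;
`2 cos A cos B = cos(A - B) + cos(A + B)` and orthogonality at `u = z ∓ (x - y)`; since
`|zᵢ ∓ (xᵢ - yᵢ)| < 2N`, divisibility by `2N` forces `u = 0`, i.e. `x - y = ±z`; the `-z` count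
equals the `z` count by the swap `(x,y) ↦ (y,x)`, and `F(-z) = F z`. (The product-to-sum step, the
small-vector lemma and the swap count are the generic helpers of the axial sibling
`js_cesaroIdentity`, reused.) The ONLY model-specific input is the transverse evenness
`Gd n (-w) = Gd n w` (`diagData_neg`): `ι(-w) + n • u = -(ι w - n • u)`, `G` is even, and
`ι w - n • u = (ι w + n • u) ∘ swap₀₁` (the swap fixes `ι w` and negates `u`), under which `G` is
invariant (Friedli–Velenik 2017, Exercise 3.14).

Contents: helpers in `CriticalTwoPointGSMJs.DiagCesaroIdentity` (the generic diagonal count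
`sum_sum_ite_mul`, the generic identity `main`, the evenness `diagData_neg`), then the registered
stub `diag_cesaroIdentity`. Nothing about measures is here; that is `diag_approximants`.
-/

namespace Summit.CriticalPhenomena.Ising3DConformalLimit.Theorems

open MeasureTheory Filter Topology
open Literature.Probability.LatticeModels
open scoped BigOperators

noncomputable section

namespace CriticalTwoPointGSMJs.DiagCesaroIdentity

open CriticalTwoPointGSMJs.JsCesaroIdentity

variable {N : ℕ} {J B : Finset (Fin 2 → ℤ)} {θ : (Fin 2 → ℤ) → (Fin 2 → ℤ) → ℝ}

/-! ## The collapsed identity for an arbitrary even weight -/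

/-- **Diagonal count, generic weight:**
`∑_{x,y ∈ B} [x - y = z'] c F(x - y) = c · #{(x,y) : x - y = z'} · F z'`. [folklore] -/
theorem sum_sum_ite_mul (B : Finset (Fin 2 → ℤ)) (F : (Fin 2 → ℤ) → ℝ) (z' : Fin 2 → ℤ)
    (c : ℝ) :
    ∑ x ∈ B, ∑ y ∈ B, (if x - y = z' then c else 0) * F (x - y) =
      c * (((B ×ˢ B).filter (fun xy => xy.1 - xy.2 = z')).card : ℝ) * F z' := by
  rw [← Finset.sum_product']
  have h : ∀ xy ∈ B ×ˢ B,
      (if xy.1 - xy.2 = z' then c else 0) * F (xy.1 - xy.2) =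
        if xy.1 - xy.2 = z' then c * F z' else 0 := by
    intro xy _
    split_ifs with hxy
    · rw [hxy]
    · rw [zero_mul]
  rw [Finset.sum_congr rfl h, ← Finset.sum_filter, Finset.sum_const, nsmul_eq_mul]
  ring

/-- **The Cesàro identity, abstract form, for an even weight.** For a subtractive phase `θ`, a
momentum set `J` with orthogonality at level `N`, a set `B ⊆ [0,N)²`, an even weight
`F : ℤ² → ℝ` and `|zᵢ| < N`:
`∑_{j ∈ J} cos(θ_j z) ∑_{x,y ∈ B} (cos(θ_j x)cos(θ_j y) + sin(θ_j x)sin(θ_j y)) F(x-y)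
 = (2N)² · #{(x,y) ∈ B × B : x - y = z} · F z`. [folklore] -/
theorem main (hθ : ∀ j z w, θ j (z - w) = θ j z - θ j w)
    (htrigN : ∀ u : Fin 2 → ℤ, ∑ j ∈ J, Real.cos (θ j u) =
      if (∀ i : Fin 2, (2 * (N : ℤ)) ∣ u i) then (2 * (N : ℝ)) ^ 2 else 0)
    (hB : ∀ x ∈ B, ∀ i : Fin 2, 0 ≤ x i ∧ x i < N)
    {F : (Fin 2 → ℤ) → ℝ} (hF : ∀ w, F (-w) = F w)
    {z : Fin 2 → ℤ} (hz : ∀ i : Fin 2, |z i| < N) :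
    ∑ j ∈ J, Real.cos (θ j z) *
        ∑ x ∈ B, ∑ y ∈ B,
          (Real.cos (θ j x) * Real.cos (θ j y) + Real.sin (θ j x) * Real.sin (θ j y)) *
            F (x - y) =
      (2 * (N : ℝ)) ^ 2 * (((B ×ˢ B).filter (fun xy => xy.1 - xy.2 = z)).card : ℝ) * F z := by
  -- Step 1: `cos a cos b + sin a sin b = cos (a - b)`, linearity of the phase, constants inside.
  have h1 : ∀ j ∈ J, Real.cos (θ j z) *
      ∑ x ∈ B, ∑ y ∈ B,
        (Real.cos (θ j x) * Real.cos (θ j y) + Real.sin (θ j x) * Real.sin (θ j y)) *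
          F (x - y) =
      ∑ x ∈ B, ∑ y ∈ B, Real.cos (θ j z) * Real.cos (θ j (x - y)) * F (x - y) := by
    intro j _
    rw [Finset.mul_sum]
    refine Finset.sum_congr rfl fun x _ => ?_
    rw [Finset.mul_sum]
    refine Finset.sum_congr rfl fun y _ => ?_
    rw [← Real.cos_sub, ← hθ]
    ring
  rw [Finset.sum_congr rfl h1, Finset.sum_comm]
  -- Step 2: swap the momentum sum inside and collapse it at each pair `(x, y)`.
  have h2 : ∀ x ∈ B, ∑ j ∈ J, ∑ y ∈ B,
      Real.cos (θ j z) * Real.cos (θ j (x - y)) * F (x - y) =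
      ∑ y ∈ B,
        (2⁻¹ * ((if x - y = z then (2 * (N : ℝ)) ^ 2 else 0) * F (x - y)) +
          2⁻¹ * ((if x - y = -z then (2 * (N : ℝ)) ^ 2 else 0) * F (x - y))) := by
    intro x hx
    rw [Finset.sum_comm]
    exact Finset.sum_congr rfl fun y hy => sum_momenta_pair hθ htrigN hB hx hy hz _
  rw [Finset.sum_congr rfl h2]
  -- Step 3: the two diagonal counts, the swap symmetry and the evenness.
  simp only [Finset.sum_add_distrib, ← Finset.mul_sum]
  rw [sum_sum_ite_mul, sum_sum_ite_mul, card_filter_sub_eq_neg, hF]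
  ring

/-! ## The model-specific input: transverse evenness of the diagonal data -/

/-- **Evenness of the diagonal data in the plane variable:** `Gd n (-w) = Gd n w`, i.e.
`G(ι(-w) + n • u) = G(ι w + n • u)` with `ι w = w 0 • (e₀ + e₁) + w 1 • e₂`, `u = e₀ - e₁`.
Indeed `ι(-w) + n • u = -(ι w - n • u)`, `G` is even, and `ι w - n • u = (ι w + n • u) ∘ swap₀₁`
(the swap fixes `ι w` and negates `u`), under which `G` is invariant (Friedli–Velenik 2017,
Exercise 3.14). [folklore] -/
theorem diagData_neg (n : ℤ) (w : Fin 2 → ℤ) :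
    criticalTwoPoint 3 ((-w) 0 • (Pi.single 0 1 + Pi.single 1 1) + (-w) 1 • Pi.single 2 1 +
        n • (Pi.single 0 1 - Pi.single 1 1)) =
      criticalTwoPoint 3 (w 0 • (Pi.single 0 1 + Pi.single 1 1) + w 1 • Pi.single 2 1 +
        n • (Pi.single 0 1 - Pi.single 1 1)) := by
  have h1 : ((-w) 0 • (Pi.single 0 1 + Pi.single 1 1) + (-w) 1 • Pi.single 2 1 +
        n • (Pi.single 0 1 - Pi.single 1 1) : Site 3) =
      -(fun i : Fin 3 =>
        (w 0 • (Pi.single 0 1 + Pi.single 1 1) + w 1 • Pi.single 2 1 +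
          n • (Pi.single 0 1 - Pi.single 1 1) : Site 3) (Equiv.swap (0 : Fin 3) 1 i)) := by
    funext l
    fin_cases l <;> simp [Equiv.swap_apply_of_ne_of_ne] <;> ring
  rw [h1, criticalTwoPoint_neg]
  exact twoPointPlus_perm_invariant_holds (d := 3) (criticalBeta_nonneg 3)
    (Equiv.swap (0 : Fin 3) 1) _

end CriticalTwoPointGSMJs.DiagCesaroIdentity

/-- **STUB `diag_cesaroIdentity` (the DIAGONAL Cesàro/DFT identity) of line `Sketch`,
canonical-lift spine, crux `CriticalTwoPointGSM`.** Given the character orthogonality `js_trigSum`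
(`∑_{j ∈ (-N,N]²} cos(πj·u/N) = (2N)²·[2N ∣ u]`, hypothesis `htrig`): for `N ≥ 1`, `n ∈ ℤ` and
`z ∈ ℤ²` with `|zᵢ| < N`, summing `cos(k_j·z)` against the quadratic forms of the coefficient
vectors `cos(k_j·x)`, `sin(k_j·x)` on the box `[0,N)²`, weighted by the diagonal data
`Gd n (x - y) = G(ι(x - y) + n • u)` (`ι w = (w₀, w₀, w₁)`, `u = e₀ - e₁`), over the `(2N)²` momenta
`k_j = πj/N`, `j ∈ (-N,N]²`, collapses to `(2N)² · #{(x,y) ∈ [0,N)²×[0,N)² : x - y = z} · Gd n z`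
(by `cos a cos b + sin a sin b = cos(a-b)`, `2 cos a cos b = cos(a-b) + cos(a+b)`, orthogonality,
`|z ± (x-y)|_∞ < 2N`, the swap `(x,y) ↦ (y,x)` and the evenness `Gd n (-z) = Gd n z`).
[folklore] -/
theorem diag_cesaroIdentity
    (htrig : ∀ N : ℕ, 1 ≤ N → ∀ u : Fin 2 → ℤ,
      ∑ j ∈ Fintype.piFinset (fun _ : Fin 2 => Finset.Ioc (-(N : ℤ)) N),
          Real.cos (∑ i : Fin 2, Real.pi * (j i : ℝ) * (u i : ℝ) / N) =
        if (∀ i : Fin 2, (2 * (N : ℤ)) ∣ u i) then (2 * (N : ℝ)) ^ 2 else 0) :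
    ∀ N : ℕ, 1 ≤ N → ∀ (n : ℤ) (z : Fin 2 → ℤ), (∀ i : Fin 2, |z i| < N) →
      ∑ j ∈ Fintype.piFinset (fun _ : Fin 2 => Finset.Ioc (-(N : ℤ)) N),
        Real.cos (∑ i : Fin 2, Real.pi * (j i : ℝ) * (z i : ℝ) / N) *
          ∑ x ∈ Fintype.piFinset (fun _ : Fin 2 => Finset.Ico (0 : ℤ) N),
            ∑ y ∈ Fintype.piFinset (fun _ : Fin 2 => Finset.Ico (0 : ℤ) N),
              (Real.cos (∑ i : Fin 2, Real.pi * (j i : ℝ) * (x i : ℝ) / N) *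
                  Real.cos (∑ i : Fin 2, Real.pi * (j i : ℝ) * (y i : ℝ) / N) +
                Real.sin (∑ i : Fin 2, Real.pi * (j i : ℝ) * (x i : ℝ) / N) *
                  Real.sin (∑ i : Fin 2, Real.pi * (j i : ℝ) * (y i : ℝ) / N)) *
              criticalTwoPoint 3 ((x - y) 0 • (Pi.single 0 1 + Pi.single 1 1) +
                (x - y) 1 • Pi.single 2 1 + n • (Pi.single 0 1 - Pi.single 1 1)) =
      (2 * (N : ℝ)) ^ 2 *
        ((((Fintype.piFinset (fun _ : Fin 2 => Finset.Ico (0 : ℤ) N)) ×ˢ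
            (Fintype.piFinset (fun _ : Fin 2 => Finset.Ico (0 : ℤ) N))).filter
            (fun xy => xy.1 - xy.2 = z)).card : ℝ) *
        criticalTwoPoint 3 (z 0 • (Pi.single 0 1 + Pi.single 1 1) + z 1 • Pi.single 2 1 +
          n • (Pi.single 0 1 - Pi.single 1 1)) := by
  intro N hN n z hz
  -- The diagonal data as an (opaque, fully elaborated) weight `F`, its evenness, then `main`.
  let F : (Fin 2 → ℤ) → ℝ := fun w =>
    criticalTwoPoint 3 (w 0 • (Pi.single 0 1 + Pi.single 1 1) + w 1 • Pi.single 2 1 +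
      n • (Pi.single 0 1 - Pi.single 1 1))
  have hF : ∀ w, F (-w) = F w := fun w => CriticalTwoPointGSMJs.DiagCesaroIdentity.diagData_neg n w
  exact CriticalTwoPointGSMJs.DiagCesaroIdentity.main
    (θ := fun j w => ∑ i : Fin 2, Real.pi * (j i : ℝ) * (w i : ℝ) / N)
    (CriticalTwoPointGSMJs.JsCesaroIdentity.phase_sub N) (fun u => htrig N hN u)
    (fun x hx => CriticalTwoPointGSMJs.JsCesaroIdentity.mem_box hx) hF hz

end

end Summit.CriticalPhenomena.Ising3DConformalLimit.Theorems
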